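import Summits.CriticalPhenomena.PercolationContinuityZ3.Theses.PercDiodeSteering
import Summits.CriticalPhenomena.PercolationContinuityZ3.Theorems.PercNearOneGluingNoHeavyLowerTailCSHTheoremOne
import Summits.CriticalPhenomena.PercolationContinuityZ3.Theorems.PercDiodeSteeringRDMonotone
import Summits.CriticalPhenomena.PercolationContinuityZ3.Theorems.PercDiodeSteeringRDEndpoint
import Literature.Probability.Percolation.ThetaContinuity
import Literature.Probability.Percolation.BernoulliPercolationProofs
import Literature.Probability.Percolation.CriticalContinuityProofs
import HarnessLib

/-!
# `PercDiodeSteering.UniformSteering` (stmt-CriticalPhenomena-7551) — SETTLED after continuity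

Item `stmt-CriticalPhenomena-7551` of route `CriticalPhenomena/PercDiodeSteering` (crux r5, 'card R4 recast as the exact
residue'): in Redner's resistor–diode coupling `θ(p, r)` (forward edges open at label `≤ p`, backward edges at label
`≤ p·r`), for every `ε > 0` there are `δ > 0` and `r₀ < 1` such that for all `r ∈ [r₀, 1)` and all
`p ∈ [p_c(r), p_c(r) + δ]`, `θ(p, r) ≤ θ(p_c(r), r) + ε`, where `p_c(r) = inf{q : θ(q, r) > 0}`.

Proof ('PercolationContinuityZ3 implies it', as the item's docstring says; the conjunct is p205010).  With `θ` the
coupled quantity of the route file: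
* `θ` is monotone in `(p, p·r)` (item 7552 `RDMonotone`, proved) and `θ(p, 1) = θ_{ℤ³}(p)` on `[0,1]` (item 7553
  `RDEndpoint`, proved); hence `θ(p, r) ≤ θ(p⁺, 1) = θ_{ℤ³}(p⁺)` for `0 ≤ r ≤ 1` (`p⁺ = max(p,0)`), and
  `θ(q, r) ≥ θ(qr, 1) = θ_{ℤ³}(qr) > 0` as soon as `p_c < qr ≤ 1` (`theta_pos_of_criticalProb_lt_holds`), so
  `p_c(r) ≤ p_c/r + η/3` (for the real `sInf`, bounded below or not);
* `θ_{ℤ³}` is continuous at `p_c` because `θ_{ℤ³}(p_c) = 0` (`continuousAt_theta_criticalProbI_iff`, Grimmett p. 202,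
  at p205010): `θ_{ℤ³}(p_c + η) < ε` for small `η`;
* with `δ = η/3` and `r₀ = max(½, p_c/(p_c + η/3))`: `p ≤ p_c(r) + δ ≤ p_c/r + 2η/3 ≤ p_c + η`, so
  `θ(p, r) ≤ θ_{ℤ³}(p_c + η) < ε ≤ θ(p_c(r), r) + ε`.
No definitions, no sorries; the constructive content (how fast the steering scale blows up) is not addressed — this is
the soft statement exactly as filed.

builds on p205010 (kernel theorem, internal audit signed; external expert review pending) — USED
(`CSH.percolationContinuityZ3_holds`).  RSW3 lane, prover P2 gen 32 (prover-prim-rsw3-p2-g32-0), METHOD '3D RSW-lite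
from continuity'.
References: S. Redner (1982) [Redner1982]; G. Grimmett, *Percolation* (1999), §8.3 p. 202 [GrimmettPercolation1999];
G. Kozma, N. Nitzan (2024) [KozmaNitzan2024].
-/

noncomputable section

namespace Summit.CriticalPhenomena.PercolationContinuityZ3.Theorems

namespace DiodeSteeringUniformSteering

open MeasureTheory Filter Literature.Probability.Percolation Literature.Probability.LatticeModels
open scoped Topology

/-- **`PercDiodeSteering.UniformSteering` (stmt-CriticalPhenomena-7551), settled** (see the module docstring for the
three-step argument: monotone coupling bounds, `θ_{ℤ³}` continuous at `p_c` by p205010, window bookkeeping).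
[cite: KozmaNitzan2024, Thm. 6 with Conj. 3 (p. 15)] -/
theorem uniformSteering_proof :
    Summit.CriticalPhenomena.PercolationContinuityZ3.Theses.PercDiodeSteering.UniformSteering := by
  unfold Summit.CriticalPhenomena.PercolationContinuityZ3.Theses.PercDiodeSteering.UniformSteering
  intro θ ε hε
  haveI := isProbabilityMeasure_labelMeasure (Site 3)
  -- the two proved items of the route, for the same `θ`
  have hmono : ∀ p p' r r' : ℝ, p ≤ p' → p * r ≤ p' * r' → θ p r ≤ θ p' r' := fun p p' r r' h1 h2 =>
    PercDiodeSteeringRDMonotone.rDMonotone_proof p p' r r' h1 h2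
  have hend : ∀ p : unitInterval, θ p 1 = theta (zdGraph 3) 0 p := fun p =>
    PercDiodeSteeringRDEndpoint.rDEndpoint_proof p
  have hθnn : ∀ p r : ℝ, 0 ≤ θ p r := fun p r => by dsimp only [θ]; exact measureReal_nonneg
  -- constants of `ℤ³`
  set pc : ℝ := criticalProb (zdGraph 3) (0 : Site 3) with hpc
  have hpc0 : 0 < pc := criticalProb_zd_pos 3 (by norm_num)
  have hpc1 : pc < 1 := criticalProb_zd_lt_one (d := 3) (by norm_num)
  have hpcI : ((criticalProbI 3 : unitInterval) : ℝ) = pc := coe_criticalProbI 3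
  -- continuity of `θ_{ℤ³}` at `p_c` (p205010)
  have h0 : theta (zdGraph 3) (0 : Site 3) (criticalProbI 3) = 0 := CSH.percolationContinuityZ3_holds
  have hcont := (continuousAt_theta_criticalProbI_iff 3).2 h0
  obtain ⟨η, hη, hηε⟩ := (Metric.continuousAt_iff.1 hcont) ε hε
  -- the working margin `η' ≤ η/2`, `η' ≤ (1 - p_c)/2`
  set η' : ℝ := min (η / 2) ((1 - pc) / 2) with hη'
  have hη'0 : 0 < η' := lt_min (by linarith) (by linarith)
  have hη'η : η' < η := lt_of_le_of_lt (min_le_left _ _) (by linarith)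
  have hη'1 : pc + η' < 1 := by have := min_le_right (η / 2) ((1 - pc) / 2); linarith
  -- `θ_{ℤ³}(p_c + η') < ε`
  set qtop : unitInterval := ⟨pc + η', ⟨by linarith, hη'1.le⟩⟩ with hqtop
  have hqtopε : theta (zdGraph 3) 0 qtop < ε := by
    have hd : dist qtop (criticalProbI 3) < η := by
      rw [Subtype.dist_eq, Real.dist_eq, hpcI]
      show |pc + η' - pc| < η
      rw [show pc + η' - pc = η' by ring, abs_of_pos hη'0]; exact hη'η
    have := hηε hd
    rw [h0, Real.dist_eq, sub_zero, abs_of_nonneg (by unfold theta; exact measureReal_nonneg)] at this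
    exact this
  -- the choice of `δ` and `r₀`
  set r₁ : ℝ := pc / (pc + η' / 3) with hr₁
  have hden : 0 < pc + η' / 3 := by linarith
  have hr₁1 : r₁ < 1 := by rw [hr₁, div_lt_one hden]; linarith
  refine ⟨η' / 3, by linarith, max r₁ (1 / 2), max_lt hr₁1 (by norm_num), fun r hr₀ hr1 p hpl hpu => ?_⟩
  have hr0 : 0 < r := lt_of_lt_of_le (by norm_num) ((le_max_right _ _).trans hr₀)
  have hrr₁ : r₁ ≤ r := (le_max_left _ _).trans hr₀
  -- `p_c / r ≤ p_c + η'/3`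
  have hpcr : pc / r ≤ pc + η' / 3 := by
    rw [div_le_iff₀ hr0]
    have : pc ≤ r * (pc + η' / 3) := by
      have h := (div_le_iff₀ hden).1 (show pc / (pc + η' / 3) ≤ r from hrr₁)
      linarith
    linarith
  -- `q₁ = p_c/r + η'/3` lies in `S_r = {q | 0 < θ q r}`
  set S : Set ℝ := {q : ℝ | 0 < θ q r} with hS
  set q₁ : ℝ := pc / r + η' / 3 with hq₁
  have hq₁0 : 0 ≤ q₁ := by positivity
  have hq₁r : q₁ * r = pc + η' / 3 * r := by
    rw [hq₁, add_mul, div_mul_cancel₀ pc hr0.ne']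
  have hq₁r_gt : pc < q₁ * r := by rw [hq₁r]; nlinarith
  have hq₁r_le : q₁ * r ≤ 1 := by rw [hq₁r]; nlinarith
  have hq₁S : q₁ ∈ S := by
    show 0 < θ q₁ r
    set w : unitInterval := ⟨q₁ * r, ⟨by linarith, hq₁r_le⟩⟩ with hw
    have hpos : 0 < theta (zdGraph 3) (0 : Site 3) w :=
      theta_pos_of_criticalProb_lt_holds (zdGraph 3) (0 : Site 3) w (by rw [hw]; exact hq₁r_gt)
    have h1 : θ (q₁ * r) 1 ≤ θ q₁ r :=
      hmono (q₁ * r) q₁ 1 r (by nlinarith) (by rw [mul_one])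
    have h2 : θ (q₁ * r) 1 = theta (zdGraph 3) 0 w := hend w
    linarith
  -- hence `sInf S ≤ q₁`
  have hinf : sInf S ≤ q₁ := by
    by_cases hb : BddBelow S
    · exact csInf_le hb hq₁S
    · rw [Real.sInf_of_not_bddBelow hb]; exact hq₁0
  -- the window: `p ≤ p_c + η'`
  have hp_le : p ≤ pc + η' := by linarith
  -- `θ p r ≤ θ_{ℤ³}(max p 0) ≤ θ_{ℤ³}(p_c + η') < ε`
  set p' : ℝ := max p 0 with hp'
  have hp'0 : 0 ≤ p' := le_max_right _ _
  have hp'le : p' ≤ pc + η' := max_le hp_le (by linarith)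
  set w' : unitInterval := ⟨p', ⟨hp'0, by linarith⟩⟩ with hw'
  have h1 : θ p r ≤ θ p' r :=
    hmono p p' r r (le_max_left _ _) (mul_le_mul_of_nonneg_right (le_max_left _ _) hr0.le)
  have h2 : θ p' r ≤ θ p' 1 := hmono p' p' r 1 le_rfl (by nlinarith)
  have h3 : θ p' 1 = theta (zdGraph 3) 0 w' := hend w'
  have h4 : theta (zdGraph 3) 0 w' ≤ theta (zdGraph 3) 0 qtop :=
    theta_mono_holds (zdGraph 3) (0 : Site 3) (show w' ≤ qtop from Subtype.coe_le_coe.1 hp'le)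
  have h5 : 0 ≤ θ (sInf S) r := hθnn _ _
  linarith

end DiodeSteeringUniformSteering

end Summit.CriticalPhenomena.PercolationContinuityZ3.Theorems

end
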